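import Mathlib
import Literature.MathematicalPhysics.QuantumFieldTheory.Balaban1983to89.B9Eq395Small

/-!
# `Balaban1983to89.B9Eq395Transport` — the realisation calculus behind "analyzed in the same way as the operator (Q′G′²Q′\*)⁻¹" (B9 p. 422): (3.95) with a projection in place of I, site embeddings (extension by zero / restriction / dilation / compression), and the transport of entry majorants between two block lattices

T. Bałaban, *Propagators for lattice gauge theories in a background field*, Commun. Math. Phys. **99**, 389–434
(1985) [Balaban1985BackgroundPropagators] (cell paper B9; PDF held `paper:balaban1985-cmp99-background-propagators`,
journal page = PDF page + 388).  Sibling of `…Balaban1983to89.B9Thm39Sum` (UNTOUCHED; its §1 `eq395_sum` types (3.95)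
as an identity in ANY ring from `hloc` and the partition of unity `hpu : Σ_□ h_□·h_□ = 1`) and of `…B9Eq395Small`
(UNTOUCHED; its `thirdSum_term_majorant` majorizes the □-term of the third sum of (3.95) over ONE `B9.Geometry`),
reusing gen-3's kernel vocabulary (`B9Thm34Inv.entry`, `hasMajorant_id_iff`), gen-4's multiplication operators
(`B9Thm37Sum.mulOp`, `mulOp_apply`; `B9Eq395Small.mulOp_mul_mulOp`) and pv08's block majorants
(`B6RandomWalk.HasMajorant`, `BlockSupp`, `hasMajorant_mono`) read through `B9Thm34Ext.toB6`.

CITATION HEADER (lean-in-tree rule 2026-08-18).  This module is a KERNEL-CHECKED BOOKKEEPING STEP of the published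
paper [Balaban1985BackgroundPropagators], pp. 408–411 and 422 [PDF 20–23, 34], verbatim:

(p. 411) *"Next let us consider the operator (Q′G′²Q′\*)⁻¹. We will find an expansion of this operator as usual
considering Q′G′²Q′\*C₀. We write it in the same way as in (2.82) [4]*
*Q′G′²Q′\*C₀ = I + Σ_□ (1 − □̃)Q′G′²Q′\*h_□C_□h_□ + Σ_□ □̃Q′(G′² − G′²_□)Q′\*h_□C_□h_□ + Σ_□ [□̃Q′G′²_□Q′\*, h_□]C_□h_□
= I − R   (3.95)"*;

(p. 409) *"The operators constructed for this sequence, which we denote by G′_□(U), C_□(U) = (Q′(U)G′²_□(U)Q′\*(U))⁻¹,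
G_□(U), satisfy all the inequalities of Theorems 3.1–3.3 correspondingly"* — the local operators live on the lattices
of the LOCAL sequence {Ω_n(□)} of p. 408 [PDF 20]: *"Let us take a cube □ ∈ 𝒟_j, and let us define a sequence
{Ω_n(□)}_{n=0,…,j+1} of domains in the following way. The cube □̃³ is either contained in B^j(Λ_j), or intersects
also the domain B^{j+1}(Λ_{j+1}). Let us assume the second case, then we defined Ω_{j+1}(□) = □̃³ ∩ B^{j+1}(Λ_{j+1}).
We take Ω_j(□) = □̃⁴, Ω_{j−1}(□) is a cube with a center at the center of □ and dist (Ω_{j−1}(□)ᶜ, Ω_j(□))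
= 2R₀M₀L^{j−1}η, and generally Ω_n(□) is a cube with a center at the center of □ and
dist(Ω_n(□)ᶜ, Ω_{n+1}(□)) = 2R₀M₀L^nη, or dist(Ω_n(□)ᶜ, □̃⁴) = 2R₀M₀L^nη + ⋯ + 2R₀M₀L^{j−1}η = 2R₀M₀L^nη
(L^{j−n} − 1/L − 1). This sequence satisfies the conditions (2.1), (2.2) with j instead of k, if rescaled from
η-lattice to L^{−j}-lattice. For n = 0 we have dist(Ω₀(□)ᶜ, □̃⁴) < 2R₀M₀L^jη, hence Ω₀(□) ⊂ □̃⁵."* ("defined" and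
the unparenthesised quotient as printed; render of PDF p. 20 read as an image).  CELL READING (not print; record
`b2b-balaban-r1/QGQ-walk-proof.md` I-1/(g)): the block lattice 𝔅(□) of this sequence agrees with the global 𝔅 on □̃³
and differs from it outside — here a HYPOTHESIS shape only (§3: injective site maps agreeing on a region);

(p. 422) *"The operators (QGQ\*)⁻¹, or (QG₁Q\*)⁻¹, can be analyzed in the same way as the operator (Q′G′²Q′\*)⁻¹. We
will not repeat these considerations here, let us write only bounds."*

WHAT IS REPRODUCED (0 sorry; nothing of the paper's end-statements is asserted).  The three "trivial but untyped"
glue steps that a literal re-run of (3.95) with LOCAL inverses C_□ on their OWN lattices 𝔅(□) needs (cell record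
`b2b-balaban-r1/QGQ-walk-proof.md` v1.1, reading R-dom and §6 last line; cross-read request (1) to the b09 lineage),
each as a kernel-checked lemma over existing declarations:
* §1 `eq395_sum_proj` — **(3.95) when the partition of unity closes to a projection**: in any ring, from `hloc` and
  Σ_□ h_□·h_□ = E (E arbitrary; E = P_𝔅 = the indicator of the global block lattice inside a larger site set 𝔖) one gets
  L·C₀ = E + S₁ + S₂ + S₃ with the SAME three sums as `B9Thm39Sum.eq395_sum` (whose proof uses `hpu` only to replace
  Σ_□ h²_□ by 1).  `eq395_sum_dummy` — the SAME identity obtained from the landed `eq395_sum` itself by adjoining ONE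
  DUMMY INDEX i₀ with h_{i₀} = □̃_{i₀} := Q, L_{i₀} = C_{i₀} := 1, Q = 1 − P_𝔅 idempotent and L·Q = Q·L = 0 (L = P_𝔅LP_𝔅):
  its `hloc` is Q³ = Q² (`dummy_hloc`), `hpu` becomes Σ = 1, its three dummy summands are 0, −Q, 0 (`dummy_term₁`,
  `dummy_term₂`, `dummy_term₃`) and its contribution to the left-hand side is L·Q·1·Q = 0 (`dummy_lhs`) — the record's
  R-dom instantiation, term by term.  `hloc_of_inverse_proj` — `hloc` for a genuine □ when the local inverse property
  reads L_□C_□ = 1_{𝔅(□)} (a projection, not 1): h_□·(□̃L_□)·C_□·h_□ = h²_□ from 1_{𝔅(□)}h_□ = h_□ and □̃h_□ = h_□.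
* §2 the SITE-EMBEDDING CALCULUS on functions on finite sets, for a site map e : T → S (injective where stated):
  extension by zero `extZero e`, restriction `restr e`, the projection `proj e = extZero ∘ restr` (= the multiplier by
  the indicator of the range, `proj_eq_mulOp`; idempotent), the DILATION `dilate e A = extZero ∘ A ∘ restr` of an
  operator on ℝ^T to ℝ^S (linear in A; MULTIPLICATIVE, `dilate_mul`; `dilate e 1 = proj e`; multipliers pass through:
  `mulOp_mul_dilate`, `dilate_mul_mulOp`) and the COMPRESSION `compress e B = restr ∘ B ∘ extZero` of an operator on ℝ^S
  to ℝ^T (linear; `compress_dilate`: compress ∘ dilate = id; `compress_proj = 1`; multiplicative as soon as one factor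
  respects the range: `compress_mul_of_right`/`_of_left`; hence `compress_identity`: L·C = proj e + R′ with
  proj e·C = C gives compress L · compress C = 1 + compress R′ — the "(3.95)_Q compressed to ℝ^𝔅 = P_𝔅ℝ^𝔖" step, after
  which `B9Thm39Sum.inverse_of_395` applies verbatim on ℝ^𝔅); ENTRIES: `entry_compress` (entries of the compression
  = entries at the embedded sites), `entry_dilate_image` / `entry_dilate_of_forall_ne_left|right` (a dilated operator
  has the old entries on the range and zero entries off it); `thirdSum_term_dilate` — the 𝔖-realised □-term of the
  third sum of (3.95), (□̃L_□h_□ − h_□□̃L_□)C_□h_□ with L_□ = dilate e L^loc, C_□ = dilate e C^loc and □̃, h_□ multipliers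
  on 𝔖, IS the dilation of the same expression formed on ℝ^{𝔅(□)} with □̃∘e, h_□∘e — so `B9Eq395Small.thirdSum_term_majorant`
  applies to it over the LOCAL geometry, literally.
* §3 TRANSPORT OF MAJORANTS: `hasMajorant_map` — pv08's `HasMajorant` is transported along an injective map of block
  lattices φ : G₁.Site → G₂.Site (block map blk ↦ φ∘blk) whenever K₁(a, b) ≦ K₂(φa, φb) and K₂ ≧ 0 (two geometries, one
  lattice); `entry_compress_dilate_le` / `hasMajorant_compress_dilate` — an operator A on ℝ^{T₁} (T₁ = 𝔅(□)) with entry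
  bounds |A(a, b)| ≦ K₁(a, b), realised on 𝔖 ⊇ e₁(T₁) ∪ e₂(T₂) and compressed to T₂ (= 𝔅), has the entry bounds K₂(y, y′)
  for any K₂ ≧ 0 dominating K₁ on the AGREEMENT REGION {e₁a = e₂y, e₁b = e₂y′} — and `localizedExp_transport`: for the
  (2.85)-shaped majorants 1_S(b)·Θ·e^{−ρδ₀d₁(a,b)} of `thirdSum_term_majorant` this holds with 1_{S′}(y′)·Θ·e^{−cρδ₀d₂(y,y′)}
  as soon as d₁ ≧ c·d₂ on the agreement region (c ≧ 0) and S is carried into S′ — WHICH DATA OF THE GEOMETRY ENTER: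
  only the site type and `dist` (the weight `P` of `thirdSum_term_majorant` is a free function, `len`/`scale` do not
  occur, and the `toB6` parameters R, H are phantom), so the transport is the identity on entries and a monotonicity
  of the exponential on rates.

WHAT IS NOT REPRODUCED (located, not claimed): the geometric facts that make the hypotheses true in print — the
agreement of the local and global block lattices, weights and averaging operators on □̃³ (p. 408 (I-1 of the record);
it presupposes □̃³ ⊂ B^j(Λ_j) ∪ B^{j+1}(Λ_{j+1})), the comparability d_□ ≧ c_d·d of the local and global multiscale
distances there ([4] (2.46); cell GAPS G-pv08-1), the support facts supp h_□ ∩ 𝔖 ⊂ e_𝔅(S_□) ⊂ e_□(𝔅(□)) — all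
hypotheses here (`hK`, `hdist`, `hS`, `hD`, `hχ`), as in every sibling; the smallness inputs of (3.95) (cell GAPS
G-B9-05/G-B9-07) and everything downstream of (3.96) (siblings `B9Thm39Sum`, `B9Eq395Small`, `B9Eq395Hom`).  Value =
kernel-checked bookkeeping of three glue steps the print and the cell record leave implicit — NOT summit progress.
Unit `b2b-balaban-b09-g8` (paper sub-cell B09, gen 8), cross-read XREAD-QGQ-WALK item (1); cell rows C-b09g8-1,
C-B9-46.  Versions: v1 = p182491 (commit be76c27e8eaf); v1.1 (same unit, DOCFIX, cell row G-b09g8-2 → C-B9-47):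
the p. 408 passage on the local sequence {Ω_n(□)} is now quoted VERBATIM from the page render (v1 carried a
paraphrase of it inside quotation marks — "sums over blocks within 2RML^nη" instead of the printed cubes with
shells 2R₀M₀L^nη at the small scale R₀M₀) and the agreement-on-□̃³ clause is labelled as a cell reading; every
declaration is byte-identical to v1.
-/

namespace Literature.MathematicalPhysics.QuantumFieldTheory.Balaban1983to89.B9Eq395Transport

open Literature.MathematicalPhysics.QuantumFieldTheory.Balaban1983to89
open Finset B9Thm37Sum

/-! ## §1  (3.95) with the partition of unity closing to a projection; the dummy index -/

section Ring

variable {A : Type*} [Ring A]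

/-- **(3.95) with Σ_□ h²_□ = E** (E any ring element; E = P_𝔅 when the identity is realised on a site set 𝔖 ⊋ 𝔅):
L·Σ_□ h_□C_□h_□ = E + Σ_□(1 − □̃)L·h_□C_□h_□ + Σ_□ □̃(L − L_□)·h_□C_□h_□ + Σ_□ (□̃L_□h_□ − h_□□̃L_□)·C_□h_□ — the three sums of
`B9Thm39Sum.eq395_sum` verbatim. [cite: Balaban1985BackgroundPropagators, (3.95) p.411; Balaban1984PropagatorsII, (2.82) p.237] -/
theorem eq395_sum_proj {ι : Type} [Fintype ι] (L E : A) (Hm Chi Cl Lloc : ι → A)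
    (hloc : ∀ i, Hm i * (Chi i * Lloc i) * Cl i * Hm i = Hm i * Hm i) (hpu : ∑ i, Hm i * Hm i = E) :
    L * (∑ i, Hm i * Cl i * Hm i) =
      E + ∑ i, (1 - Chi i) * L * (Hm i * Cl i * Hm i) + ∑ i, Chi i * (L - Lloc i) * (Hm i * Cl i * Hm i) +
        ∑ i, (Chi i * Lloc i * Hm i - Hm i * (Chi i * Lloc i)) * Cl i * Hm i := by
  have hterm : ∀ i, L * (Hm i * Cl i * Hm i) = Hm i * Hm i + ((1 - Chi i) * L * (Hm i * Cl i * Hm i) +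
      Chi i * (L - Lloc i) * (Hm i * Cl i * Hm i) + (Chi i * Lloc i * Hm i - Hm i * (Chi i * Lloc i)) * Cl i * Hm i) := by
    intro i
    have h : L * (Hm i * Cl i * Hm i) = Hm i * (Chi i * Lloc i) * Cl i * Hm i +
        ((1 - Chi i) * L * (Hm i * Cl i * Hm i) + Chi i * (L - Lloc i) * (Hm i * Cl i * Hm i) +
          (Chi i * Lloc i * Hm i - Hm i * (Chi i * Lloc i)) * Cl i * Hm i) := by
      noncomm_ring
    rw [hloc i] at h
    exact h
  rw [Finset.mul_sum, Finset.sum_congr rfl fun i _ => hterm i, Finset.sum_add_distrib, hpu, Finset.sum_add_distrib,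
    Finset.sum_add_distrib]
  abel

/-- Q² = Q for Q = 1 − P with P idempotent (Q = 1_{𝔖∖𝔅}). [folklore] -/
theorem oneSub_idem (P : A) (hP : P * P = P) : (1 - P) * (1 - P) = 1 - P := by
  simp only [mul_sub, sub_mul, one_mul, mul_one, hP, sub_self, sub_zero]

/-- The dummy index: its `hloc` is Q·(Q·1)·1·Q = Q·Q (both sides = Q). [folklore] -/
theorem dummy_hloc (Q : A) (hQ : Q * Q = Q) : Q * (Q * 1) * 1 * Q = Q * Q := by
  simp only [mul_one, hQ]

/-- The dummy index: its first summand (1 − Q)·L·(Q·1·Q) vanishes when L·Q = 0. [folklore] -/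
theorem dummy_term₁ (L Q : A) (hLQ : L * Q = 0) : (1 - Q) * L * (Q * 1 * Q) = 0 := by
  rw [mul_one, mul_assoc, ← mul_assoc L, hLQ, zero_mul, mul_zero]

/-- The dummy index: its second summand Q·(L − 1)·(Q·1·Q) is −Q when Q·L = 0 and Q² = Q. [folklore] -/
theorem dummy_term₂ (L Q : A) (hQ : Q * Q = Q) (hQL : Q * L = 0) : Q * (L - 1) * (Q * 1 * Q) = -Q := by
  rw [mul_one, hQ, mul_sub, hQL, zero_sub, mul_one, neg_mul, hQ]

/-- The dummy index: its third summand (Q·1·Q − Q·(Q·1))·1·Q vanishes identically. [folklore] -/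
theorem dummy_term₃ (Q : A) : (Q * 1 * Q - Q * (Q * 1)) * 1 * Q = 0 := by
  simp only [mul_one, sub_self, zero_mul]

/-- The dummy index: its contribution L·(Q·1·Q) to L·C₀ vanishes when L·Q = 0. [folklore] -/
theorem dummy_lhs (L Q : A) (hLQ : L * Q = 0) : L * (Q * 1 * Q) = 0 := by
  rw [mul_one, ← mul_assoc, hLQ, zero_mul]

/-- **(3.95) realised with local spaces, by ONE DUMMY INDEX** (the cell record's reading R-dom, derived from the landed
`B9Thm39Sum.eq395_sum` itself): adjoin i₀ with h_{i₀} = □̃_{i₀} := Q, L_{i₀} = C_{i₀} := 1, where Q = 1 − P_𝔅 is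
idempotent, L·Q = Q·L = 0 (L = P_𝔅LP_𝔅) and Σ_□ h²_□ = 1 − Q; then `eq395_sum` over `Option ι` is, after the dummy
summands are evaluated (0, −Q, 0; `hloc` = Q³ = Q²; left-hand contribution 0), the identity of `eq395_sum_proj` with
E = 1 − Q. [cite: Balaban1985BackgroundPropagators, (3.95) p.411 + p.422] -/
theorem eq395_sum_dummy {ι : Type} [Fintype ι] (L Q : A) (Hm Chi Cl Lloc : ι → A)
    (hQ : Q * Q = Q) (hLQ : L * Q = 0) (hQL : Q * L = 0)
    (hloc : ∀ i, Hm i * (Chi i * Lloc i) * Cl i * Hm i = Hm i * Hm i) (hpu : ∑ i, Hm i * Hm i = 1 - Q) :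
    L * (∑ i, Hm i * Cl i * Hm i) =
      (1 - Q) + ∑ i, (1 - Chi i) * L * (Hm i * Cl i * Hm i) + ∑ i, Chi i * (L - Lloc i) * (Hm i * Cl i * Hm i) +
        ∑ i, (Chi i * Lloc i * Hm i - Hm i * (Chi i * Lloc i)) * Cl i * Hm i := by
  have hloc' : ∀ o : Option ι, (o.elim Q Hm) * ((o.elim Q Chi) * (o.elim 1 Lloc)) * (o.elim 1 Cl) * (o.elim Q Hm) =
      (o.elim Q Hm) * (o.elim Q Hm) := by
    intro o
    cases o with
    | none => simpa only [Option.elim_none] using dummy_hloc Q hQ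
    | some i => simpa only [Option.elim_some] using hloc i
  have hpu' : ∑ o : Option ι, (o.elim Q Hm) * (o.elim Q Hm) = 1 := by
    rw [Fintype.sum_option]
    simp only [Option.elim_none, Option.elim_some, hQ, hpu]
    abel
  have h := B9Thm39Sum.eq395_sum L (fun o : Option ι => o.elim Q Hm) (fun o => o.elim Q Chi) (fun o => o.elim 1 Cl)
    (fun o => o.elim 1 Lloc) hloc' hpu'
  simp only [Fintype.sum_option, Option.elim_none, Option.elim_some] at h
  rw [mul_add, dummy_lhs L Q hLQ, zero_add, dummy_term₁ L Q hLQ, dummy_term₂ L Q hQ hQL, dummy_term₃ Q] at h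
  rw [h]
  abel

/-- **`hloc` for a genuine □ when the local problem lives on its own lattice**: from L_□·C_□ = D (D = 1_{𝔅(□)}, the
identity of the local space realised in 𝔖), D·h_□ = h_□ (supp h_□ ⊂ 𝔅(□)) and □̃·h_□ = h_□:
h_□·(□̃L_□)·C_□·h_□ = h_□·h_□ (`B9Thm39Sum.hloc_of_inverse` is the case D = 1).
[cite: Balaban1985BackgroundPropagators, (3.87) p.409 + (3.95) p.411] -/
theorem hloc_of_inverse_proj {Hm Chi Cl Lloc D : A} (hinv : Lloc * Cl = D) (hD : D * Hm = Hm) (hχ : Chi * Hm = Hm) :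
    Hm * (Chi * Lloc) * Cl * Hm = Hm * Hm := by
  calc Hm * (Chi * Lloc) * Cl * Hm = Hm * Chi * (Lloc * Cl) * Hm := by noncomm_ring
    _ = Hm * (Chi * (D * Hm)) := by rw [hinv]; noncomm_ring
    _ = Hm * Hm := by rw [hD, hχ]

end Ring

/-! ## §2  Site embeddings: extension by zero, restriction, projection, dilation, compression -/

section Embedding

variable {S T : Type} [Fintype T] [DecidableEq S]

/-- Extension by zero along a site map e : T → S: (ext f)(s) = Σ_t 1_{e t = s} f(t) (= f(t) at s = e t for e injective,
0 off the range). [folklore] -/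
def extZero (e : T → S) : (T → ℝ) →ₗ[ℝ] (S → ℝ) where
  toFun f := fun s => ∑ t, if e t = s then f t else 0
  map_add' f f' := by
    funext s
    simp only [Pi.add_apply]
    rw [← Finset.sum_add_distrib]
    exact Finset.sum_congr rfl fun t _ => by split_ifs <;> simp
  map_smul' r f := by
    funext s
    simp only [Pi.smul_apply, smul_eq_mul, RingHom.id_apply, Finset.mul_sum]
    exact Finset.sum_congr rfl fun t _ => by split_ifs <;> simp

/-- Restriction along e: (res F)(t) = F(e t). [folklore] -/
def restr (e : T → S) : (S → ℝ) →ₗ[ℝ] (T → ℝ) where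
  toFun F := fun t => F (e t)
  map_add' _ _ := rfl
  map_smul' _ _ := rfl

omit [Fintype T] [DecidableEq S] in
/-- Unfolding equation of `restr`. [folklore] -/
@[simp] theorem restr_apply (e : T → S) (F : S → ℝ) (t : T) : restr e F t = F (e t) := rfl

/-- Unfolding equation of `extZero`. [folklore] -/
theorem extZero_apply (e : T → S) (f : T → ℝ) (s : S) : extZero e f s = ∑ t, if e t = s then f t else 0 := rfl

/-- On the range of an injective e the extension by zero reproduces f. [folklore] -/
theorem extZero_apply_image {e : T → S} (he : Function.Injective e) (f : T → ℝ) (t : T) : extZero e f (e t) = f t := by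
  rw [extZero_apply, Finset.sum_eq_single t]
  · rw [if_pos rfl]
  · intro t' _ ht'
    exact if_neg fun h => ht' (he h)
  · intro h
    exact absurd (Finset.mem_univ t) h

/-- Off the range the extension by zero vanishes. [folklore] -/
theorem extZero_apply_of_forall_ne (e : T → S) (f : T → ℝ) {s : S} (hs : ∀ t, e t ≠ s) : extZero e f s = 0 :=
  Finset.sum_eq_zero fun t _ => if_neg (hs t)

/-- res ∘ ext = id for e injective. [folklore] -/
theorem restr_extZero {e : T → S} (he : Function.Injective e) (f : T → ℝ) : restr e (extZero e f) = f :=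
  funext fun t => extZero_apply_image he f t

omit [Fintype T] [DecidableEq S] in
/-- Restriction of a product with a multiplier: res(h·F) = (h∘e)·res F. [folklore] -/
theorem restr_mulOp (e : T → S) (h F : S → ℝ) : restr e (mulOp h F) = mulOp (h ∘ e) (restr e F) := rfl

variable [DecidableEq T]

/-- ext(δ_{t′}) = δ_{e t′} for e injective. [folklore] -/
theorem extZero_single {e : T → S} (he : Function.Injective e) (t' : T) :
    extZero e (Pi.single t' (1 : ℝ)) = Pi.single (e t') (1 : ℝ) := by
  funext s
  by_cases hs : ∃ t, e t = s
  · obtain ⟨t, rfl⟩ := hs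
    rw [extZero_apply_image he]
    by_cases ht : t = t'
    · rw [ht, Pi.single_eq_same, Pi.single_eq_same]
    · rw [Pi.single_eq_of_ne ht, Pi.single_eq_of_ne fun h => ht (he h)]
  · rw [extZero_apply_of_forall_ne e _ fun t h => hs ⟨t, h⟩, Pi.single_eq_of_ne fun h => hs ⟨t', h.symm⟩]

omit [Fintype T] in
/-- res(δ_{e t′}) = δ_{t′} for e injective. [folklore] -/
theorem restr_single {e : T → S} (he : Function.Injective e) (t' : T) :
    restr e (Pi.single (e t') (1 : ℝ)) = Pi.single t' (1 : ℝ) := by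
  funext t
  rw [restr_apply]
  by_cases ht : t = t'
  · rw [ht, Pi.single_eq_same, Pi.single_eq_same]
  · rw [Pi.single_eq_of_ne ht, Pi.single_eq_of_ne fun h => ht (he h)]

omit [Fintype T] [DecidableEq T] in
/-- res(δ_{s′}) = 0 for s′ off the range. [folklore] -/
theorem restr_single_of_forall_ne (e : T → S) {s' : S} (hs' : ∀ t, e t ≠ s') :
    restr e (Pi.single s' (1 : ℝ)) = 0 := by
  funext t
  rw [restr_apply, Pi.zero_apply, Pi.single_eq_of_ne (hs' t)]

omit [DecidableEq T] in
/-- The projection P_e = ext ∘ res onto the functions supported on the range of e (P_𝔅, 1_{𝔅(□)}). [folklore] -/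
def proj (e : T → S) : Module.End ℝ (S → ℝ) := extZero e ∘ₗ restr e

omit [DecidableEq T] in
/-- Unfolding equation of `proj`. [folklore] -/
theorem proj_apply (e : T → S) (F : S → ℝ) : proj e F = extZero e (restr e F) := rfl

omit [DecidableEq T] in
/-- P_e F = F on the range. [folklore] -/
theorem proj_apply_image {e : T → S} (he : Function.Injective e) (F : S → ℝ) (t : T) : proj e F (e t) = F (e t) := by
  rw [proj_apply, extZero_apply_image he, restr_apply]

omit [DecidableEq T] in
/-- P_e F = 0 off the range. [folklore] -/
theorem proj_apply_of_forall_ne (e : T → S) (F : S → ℝ) {s : S} (hs : ∀ t, e t ≠ s) : proj e F s = 0 :=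
  extZero_apply_of_forall_ne e _ hs

omit [DecidableEq T] in
open Classical in
/-- P_e is the multiplier by the indicator of the range of e. [folklore] -/
theorem proj_eq_mulOp {e : T → S} (he : Function.Injective e) :
    proj e = mulOp (fun s => if ∃ t, e t = s then (1 : ℝ) else 0) := by
  apply LinearMap.ext
  intro F
  funext s
  by_cases hs : ∃ t, e t = s
  · obtain ⟨t, rfl⟩ := hs
    rw [proj_apply_image he, mulOp_apply, if_pos ⟨t, rfl⟩, one_mul]
  · rw [proj_apply_of_forall_ne e F fun t h => hs ⟨t, h⟩, mulOp_apply, if_neg hs, zero_mul]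

omit [DecidableEq T] in
/-- P_e is idempotent. [folklore] -/
theorem proj_mul_proj {e : T → S} (he : Function.Injective e) : proj e * proj e = proj e := by
  apply LinearMap.ext
  intro F
  rw [Module.End.mul_apply, proj_apply, proj_apply, restr_extZero he]

omit [DecidableEq T] in
/-- P_e fixes a multiplier supported on the range: P_e·h = h if h vanishes off the range. [folklore] -/
theorem proj_mul_mulOp {e : T → S} (he : Function.Injective e) (h : S → ℝ) (hh : ∀ s, (∀ t, e t ≠ s) → h s = 0) :
    proj e * mulOp h = mulOp h := by
  apply LinearMap.ext
  intro F
  funext s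
  rw [Module.End.mul_apply]
  by_cases hs : ∃ t, e t = s
  · obtain ⟨t, rfl⟩ := hs
    rw [proj_apply_image he]
  · have hs' : ∀ t, e t ≠ s := fun t ht => hs ⟨t, ht⟩
    rw [proj_apply_of_forall_ne e _ hs', mulOp_apply, hh s hs', zero_mul]

omit [DecidableEq T] in
/-- Symmetrically h·P_e = h. [folklore] -/
theorem mulOp_mul_proj {e : T → S} (he : Function.Injective e) (h : S → ℝ) (hh : ∀ s, (∀ t, e t ≠ s) → h s = 0) :
    mulOp h * proj e = mulOp h := by
  apply LinearMap.ext
  intro F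
  funext s
  rw [Module.End.mul_apply, mulOp_apply, mulOp_apply]
  by_cases hs : ∃ t, e t = s
  · obtain ⟨t, rfl⟩ := hs
    rw [proj_apply_image he]
  · have hs' : ∀ t, e t ≠ s := fun t ht => hs ⟨t, ht⟩
    rw [hh s hs', zero_mul, zero_mul]

omit [DecidableEq T] in
/-- **Dilation**: an operator A on ℝ^T realised on ℝ^S as ext ∘ A ∘ res (zero off the range). Linear in A. [folklore] -/
def dilate (e : T → S) : Module.End ℝ (T → ℝ) →ₗ[ℝ] Module.End ℝ (S → ℝ) where
  toFun A := extZero e ∘ₗ A ∘ₗ restr e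
  map_add' A B := by
    apply LinearMap.ext
    intro F
    simp only [LinearMap.comp_apply, LinearMap.add_apply, map_add]
  map_smul' r A := by
    apply LinearMap.ext
    intro F
    simp only [LinearMap.comp_apply, LinearMap.smul_apply, map_smul, RingHom.id_apply]

omit [DecidableEq T] in
/-- Unfolding equation of `dilate`. [folklore] -/
theorem dilate_apply (e : T → S) (A : Module.End ℝ (T → ℝ)) (F : S → ℝ) :
    dilate e A F = extZero e (A (restr e F)) := rfl

omit [DecidableEq T] in
/-- The dilation is MULTIPLICATIVE (e injective): dilate(AB) = dilate A · dilate B. [folklore] -/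
theorem dilate_mul {e : T → S} (he : Function.Injective e) (A B : Module.End ℝ (T → ℝ)) :
    dilate e (A * B) = dilate e A * dilate e B := by
  apply LinearMap.ext
  intro F
  rw [Module.End.mul_apply, dilate_apply, dilate_apply, dilate_apply, restr_extZero he, Module.End.mul_apply]

omit [DecidableEq T] in
/-- dilate 1 = P_e (the local identity becomes the indicator of the local lattice: L_□C_□ = 1_{𝔅(□)}). [folklore] -/
theorem dilate_one (e : T → S) : dilate e 1 = proj e := rfl

omit [DecidableEq T] in
/-- P_e · dilate A = dilate A. [folklore] -/
theorem proj_mul_dilate {e : T → S} (he : Function.Injective e) (A : Module.End ℝ (T → ℝ)) :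
    proj e * dilate e A = dilate e A := by
  rw [← dilate_one, ← dilate_mul he, one_mul]

omit [DecidableEq T] in
/-- dilate A · P_e = dilate A. [folklore] -/
theorem dilate_mul_proj {e : T → S} (he : Function.Injective e) (A : Module.End ℝ (T → ℝ)) :
    dilate e A * proj e = dilate e A := by
  rw [← dilate_one, ← dilate_mul he, mul_one]

omit [DecidableEq T] in
/-- A multiplier on ℝ^S in front of a dilation is the dilation with the restricted multiplier in front (e injective):
χ·dilate A = dilate((χ∘e)·A). [folklore] -/
theorem mulOp_mul_dilate {e : T → S} (he : Function.Injective e) (χ : S → ℝ) (A : Module.End ℝ (T → ℝ)) :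
    mulOp χ * dilate e A = dilate e (mulOp (χ ∘ e) * A) := by
  apply LinearMap.ext
  intro F
  funext s
  rw [Module.End.mul_apply, mulOp_apply, dilate_apply, dilate_apply, Module.End.mul_apply]
  by_cases hs : ∃ t, e t = s
  · obtain ⟨t, rfl⟩ := hs
    rw [extZero_apply_image he, extZero_apply_image he, mulOp_apply, Function.comp_apply]
  · have hs' : ∀ t, e t ≠ s := fun t ht => hs ⟨t, ht⟩
    rw [extZero_apply_of_forall_ne e _ hs', extZero_apply_of_forall_ne e _ hs', mul_zero]

omit [DecidableEq T] in
/-- A multiplier on ℝ^S behind a dilation: dilate A · h = dilate(A·(h∘e)). [folklore] -/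
theorem dilate_mul_mulOp (e : T → S) (h : S → ℝ) (A : Module.End ℝ (T → ℝ)) :
    dilate e A * mulOp h = dilate e (A * mulOp (h ∘ e)) := by
  apply LinearMap.ext
  intro F
  rw [Module.End.mul_apply, dilate_apply, dilate_apply, Module.End.mul_apply, restr_mulOp]

omit [DecidableEq T] in
/-- **The 𝔖-realised □-term of the third sum of (3.95) is the dilation of the local-space term**: with L_□ = dilate e L,
C_□ = dilate e C (L, C operators on ℝ^{𝔅(□)}, e : 𝔅(□) → 𝔖 injective) and the multipliers □̃ = χ, h_□ = h on 𝔖,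
(□̃L_□h_□ − h_□□̃L_□)C_□h_□ = dilate e ((χ′Lh′ − h′χ′L)Ch′), χ′ = χ∘e, h′ = h∘e — so `B9Eq395Small.thirdSum_term_majorant`
applies over the LOCAL geometry. [cite: Balaban1985BackgroundPropagators, (3.95) p.411 + p.422] -/
theorem thirdSum_term_dilate {e : T → S} (he : Function.Injective e) (χ h : S → ℝ) (L C : Module.End ℝ (T → ℝ)) :
    (mulOp χ * dilate e L * mulOp h - mulOp h * (mulOp χ * dilate e L)) * dilate e C * mulOp h =
      dilate e ((mulOp (χ ∘ e) * L * mulOp (h ∘ e) - mulOp (h ∘ e) * (mulOp (χ ∘ e) * L)) * C * mulOp (h ∘ e)) := by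
  rw [mulOp_mul_dilate he χ L, dilate_mul_mulOp e h, mulOp_mul_dilate he h, ← map_sub, ← dilate_mul he,
    dilate_mul_mulOp e h]

omit [DecidableEq T] in
/-- **Compression**: an operator B on ℝ^S read on ℝ^T as res ∘ B ∘ ext. Linear in B. [folklore] -/
def compress (e : T → S) : Module.End ℝ (S → ℝ) →ₗ[ℝ] Module.End ℝ (T → ℝ) where
  toFun B := restr e ∘ₗ B ∘ₗ extZero e
  map_add' B C := by
    apply LinearMap.ext
    intro f
    simp only [LinearMap.comp_apply, LinearMap.add_apply, map_add]
  map_smul' r B := by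
    apply LinearMap.ext
    intro f
    simp only [LinearMap.comp_apply, LinearMap.smul_apply, map_smul, RingHom.id_apply]

omit [DecidableEq T] in
/-- Unfolding equation of `compress`. [folklore] -/
theorem compress_apply (e : T → S) (B : Module.End ℝ (S → ℝ)) (f : T → ℝ) :
    compress e B f = restr e (B (extZero e f)) := rfl

omit [DecidableEq T] in
/-- compress ∘ dilate = id (e injective): the global operator realised on 𝔖 and read back on 𝔅 is itself. [folklore] -/
theorem compress_dilate {e : T → S} (he : Function.Injective e) (A : Module.End ℝ (T → ℝ)) :
    compress e (dilate e A) = A := by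
  apply LinearMap.ext
  intro f
  rw [compress_apply, dilate_apply, restr_extZero he, restr_extZero he]

omit [DecidableEq T] in
/-- compress P_e = 1. [folklore] -/
theorem compress_proj {e : T → S} (he : Function.Injective e) : compress e (proj e) = 1 := by
  rw [← dilate_one, compress_dilate he]

omit [DecidableEq T] in
/-- compress 1 = 1. [folklore] -/
theorem compress_one {e : T → S} (he : Function.Injective e) : compress e (1 : Module.End ℝ (S → ℝ)) = 1 := by
  apply LinearMap.ext
  intro f
  rw [compress_apply, Module.End.one_apply, restr_extZero he, Module.End.one_apply]

omit [DecidableEq T] in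
/-- The compression is multiplicative when the RIGHT factor maps into range-supported functions (P_e·C = C). [folklore] -/
theorem compress_mul_of_right (e : T → S) {B C : Module.End ℝ (S → ℝ)}
    (hC : proj e * C = C) : compress e (B * C) = compress e B * compress e C := by
  apply LinearMap.ext
  intro f
  rw [compress_apply, Module.End.mul_apply, Module.End.mul_apply, compress_apply, compress_apply, ← proj_apply]
  conv_lhs => rw [← hC, Module.End.mul_apply]

omit [DecidableEq T] in
/-- The compression is multiplicative when the LEFT factor only reads range-supported parts (B·P_e = B). [folklore] -/
theorem compress_mul_of_left (e : T → S) {B C : Module.End ℝ (S → ℝ)}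
    (hB : B * proj e = B) : compress e (B * C) = compress e B * compress e C := by
  apply LinearMap.ext
  intro f
  rw [compress_apply, Module.End.mul_apply, Module.End.mul_apply, compress_apply, compress_apply, ← proj_apply]
  conv_lhs => rw [← hB, Module.End.mul_apply]

omit [DecidableEq T] in
/-- **(3.95)_Q compressed to ℝ^𝔅 = P_𝔅ℝ^𝔖**: from L·C₀ = P_e + R′ in End(ℝ^𝔖) with P_e·C₀ = C₀ (C₀ = Σ_□ h_□C_□h_□ begins with
h_□, supported in 𝔅): compress L · compress C₀ = 1 + compress R′ on ℝ^𝔅 — the form `B9Thm39Sum.inverse_of_395` consumes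
(with R := −compress R′). [cite: Balaban1985BackgroundPropagators, (3.95)–(3.96) p.411] -/
theorem compress_identity {e : T → S} (he : Function.Injective e) {L C Rm : Module.End ℝ (S → ℝ)}
    (h : L * C = proj e + Rm) (hC : proj e * C = C) : compress e L * compress e C = 1 + compress e Rm := by
  rw [← compress_mul_of_right e hC, h, map_add, compress_proj he]

/-- **Entries of a compression** = the entries at the embedded sites. [folklore] -/
theorem entry_compress {e : T → S} (he : Function.Injective e) (B : Module.End ℝ (S → ℝ)) (t t' : T) :
    B9Thm34Inv.entry (compress e B) t t' = B9Thm34Inv.entry B (e t) (e t') := by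
  rw [B9Thm34Inv.entry, B9Thm34Inv.entry, compress_apply, restr_apply, extZero_single he]

/-- **Entries of a dilation on the range** = the old entries. [folklore] -/
theorem entry_dilate_image {e : T → S} (he : Function.Injective e) (A : Module.End ℝ (T → ℝ)) (t t' : T) :
    B9Thm34Inv.entry (dilate e A) (e t) (e t') = B9Thm34Inv.entry A t t' := by
  rw [B9Thm34Inv.entry, B9Thm34Inv.entry, dilate_apply, restr_single he, extZero_apply_image he]

omit [DecidableEq T] in
/-- A dilation has zero entries in the rows off the range. [folklore] -/
theorem entry_dilate_of_forall_ne_left (e : T → S) (A : Module.End ℝ (T → ℝ)) {s : S} (hs : ∀ t, e t ≠ s) (s' : S) :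
    B9Thm34Inv.entry (dilate e A) s s' = 0 := by
  rw [B9Thm34Inv.entry, dilate_apply, extZero_apply_of_forall_ne e _ hs]

omit [DecidableEq T] in
/-- A dilation has zero entries in the columns off the range. [folklore] -/
theorem entry_dilate_of_forall_ne_right (e : T → S) (A : Module.End ℝ (T → ℝ)) (s : S) {s' : S} (hs' : ∀ t, e t ≠ s') :
    B9Thm34Inv.entry (dilate e A) s s' = 0 := by
  rw [B9Thm34Inv.entry, dilate_apply, restr_single_of_forall_ne e hs', map_zero, map_zero, Pi.zero_apply]

end Embedding

/-! ## §3  Transport of majorants between two block lattices -/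

section Transport

/-- **Transport of pv08's block majorants along an injective map of block lattices** (one lattice X, two geometries):
if T has the majorant K₁ w.r.t. the block map blk : X → G₁.Site, φ : G₁.Site → G₂.Site is injective, K₁(a, b) ≦ K₂(φa, φb)
and K₂ ≧ 0, then T has the majorant K₂ w.r.t. φ∘blk. [cite: Balaban1984PropagatorsII, (2.51) p.232] -/
theorem hasMajorant_map {G₁ G₂ : B6.Geometry} {X : Type} (φ : G₁.Site → G₂.Site) (hφ : Function.Injective φ)
    (blk : X → G₁.Site) {T : Module.End ℝ (X → ℝ)} {K₁ : G₁.Site → G₁.Site → ℝ} {K₂ : G₂.Site → G₂.Site → ℝ}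
    (hT : B6RandomWalk.HasMajorant (g := G₁) blk T K₁) (hK : ∀ a b, K₁ a b ≤ K₂ (φ a) (φ b))
    (hK₂ : ∀ a b, 0 ≤ K₂ a b) :
    B6RandomWalk.HasMajorant (g := G₂) (φ ∘ blk) T K₂ := by
  intro y' μ B hμ x
  by_cases hy' : ∃ b, φ b = y'
  · obtain ⟨b, rfl⟩ := hy'
    have hμ' : B6RandomWalk.BlockSupp (g := G₁) blk μ b B :=
      ⟨hμ.nonneg, fun x' hx' => hμ.bound x' (by rw [Function.comp_apply, hx']),
        fun x' hx' => hμ.off x' fun h => hx' (hφ h)⟩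
    exact (hT b μ B hμ' x).trans (mul_le_mul_of_nonneg_right (hK _ _) hμ.nonneg)
  · have hμ0 : μ = 0 := funext fun x' => hμ.off x' fun h => hy' ⟨blk x', h⟩
    rw [hμ0, map_zero, Pi.zero_apply, abs_zero]
    exact mul_nonneg (hK₂ _ _) hμ.nonneg

variable {S T₁ T₂ : Type} [Fintype T₁] [DecidableEq T₁] [Fintype T₂] [DecidableEq T₂] [DecidableEq S]

/-- **Entry bounds survive realisation-and-compression**: an operator A on ℝ^{T₁} with |A(a, b)| ≦ K₁(a, b), dilated
along e₁ : T₁ → 𝔖 and compressed along e₂ : T₂ → 𝔖, has |entry(y, y′)| ≦ K₂(y, y′) for every K₂ ≧ 0 that dominates K₁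
on the AGREEMENT REGION e₁a = e₂y, e₁b = e₂y′ (elsewhere the entries vanish). [folklore] -/
theorem entry_compress_dilate_le {e₁ : T₁ → S} {e₂ : T₂ → S} (he₁ : Function.Injective e₁)
    (he₂ : Function.Injective e₂) (A : Module.End ℝ (T₁ → ℝ)) (K₁ : T₁ → T₁ → ℝ) (K₂ : T₂ → T₂ → ℝ)
    (hA : ∀ a b, |B9Thm34Inv.entry A a b| ≤ K₁ a b) (hK₂ : ∀ y y', 0 ≤ K₂ y y')
    (hK : ∀ a b y y', e₁ a = e₂ y → e₁ b = e₂ y' → K₁ a b ≤ K₂ y y') (y y' : T₂) :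
    |B9Thm34Inv.entry (compress e₂ (dilate e₁ A)) y y'| ≤ K₂ y y' := by
  rw [entry_compress he₂]
  by_cases hy : ∃ a, e₁ a = e₂ y
  · obtain ⟨a, ha⟩ := hy
    by_cases hy' : ∃ b, e₁ b = e₂ y'
    · obtain ⟨b, hb⟩ := hy'
      rw [← ha, ← hb, entry_dilate_image he₁]
      exact (hA a b).trans (hK a b y y' ha hb)
    · rw [entry_dilate_of_forall_ne_right e₁ A _ fun b h => hy' ⟨b, h⟩, abs_zero]
      exact hK₂ y y'
  · rw [entry_dilate_of_forall_ne_left e₁ A (fun a h => hy ⟨a, h⟩), abs_zero]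
    exact hK₂ y y'

/-- **Transport of majorants from the local block lattice 𝔅(□) to 𝔅** in pv08's `HasMajorant` form (block map =
identity on both lattices, majorants = entry bounds by `B9Thm34Inv.hasMajorant_id_iff`): only the site types and the
majorant functions enter — of the two `B9.Geometry` structures nothing but `Site` (and, through K₁, K₂, whatever the
user put there, e.g. `dist`) is used; the `toB6` parameters R, H are phantom.
[cite: Balaban1985BackgroundPropagators, p.408 + p.422; Balaban1984PropagatorsII, (2.51) p.232] -/
theorem hasMajorant_compress_dilate {g₁ g₂ : B9.Geometry} [Fintype g₁.Site] [DecidableEq g₁.Site] [Fintype g₂.Site]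
    [DecidableEq g₂.Site] {R₁ R₂ : ℝ} {H₁ H₂ : Prop} {e₁ : g₁.Site → S} {e₂ : g₂.Site → S}
    (he₁ : Function.Injective e₁) (he₂ : Function.Injective e₂) {A : Module.End ℝ (g₁.Site → ℝ)}
    {K₁ : g₁.Site → g₁.Site → ℝ} (K₂ : g₂.Site → g₂.Site → ℝ)
    (hA : B6RandomWalk.HasMajorant (g := B9Thm34Ext.toB6 g₁ R₁ H₁) (fun x : g₁.Site => x) A K₁)
    (hK₂ : ∀ y y', 0 ≤ K₂ y y') (hK : ∀ a b y y', e₁ a = e₂ y → e₁ b = e₂ y' → K₁ a b ≤ K₂ y y') :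
    B6RandomWalk.HasMajorant (g := B9Thm34Ext.toB6 g₂ R₂ H₂) (fun x : g₂.Site => x) (compress e₂ (dilate e₁ A)) K₂ :=
  (B9Thm34Inv.hasMajorant_id_iff (R := R₂) (H := H₂) _ _).mpr
    (entry_compress_dilate_le he₁ he₂ A K₁ K₂ ((B9Thm34Inv.hasMajorant_id_iff (R := R₁) (H := H₁) _ _).mp hA) hK₂ hK)

/-- Rates: if c·d₂ ≦ d₁ and Θ, ρ ≧ 0 then Θe^{−ρd₁} ≦ Θe^{−cρd₂}. [folklore] -/
theorem exp_rate_le_of_dist_ge (Θ ρ c d₁ d₂ : ℝ) (hΘ : 0 ≤ Θ) (hρ : 0 ≤ ρ) (h : c * d₂ ≤ d₁) :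
    Θ * Real.exp (-(ρ * d₁)) ≤ Θ * Real.exp (-(c * ρ * d₂)) := by
  refine mul_le_mul_of_nonneg_left (Real.exp_le_exp.mpr ?_) hΘ
  have := mul_le_mul_of_nonneg_left h hρ
  nlinarith

/-- **The (2.85)-shaped output of `B9Eq395Small.thirdSum_term_majorant` over the LOCAL geometry, read on 𝔅**: if A on
ℝ^{𝔅(□)} has the majorant 1_S(b)·Θ·e^{−ρδ₀d₁(a,b)} (Θ, ρ, δ₀ ≧ 0), the local and global lattices are embedded in 𝔖 by
e₁, e₂, on the agreement region d₁(a, b) ≧ c·d₂(y, y′) (c ≧ 0: comparability of the local and global multiscale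
distances on □̃³) and S is carried into S′, then the compressed operator has the majorant 1_{S′}(y′)·Θ·e^{−cρδ₀d₂(y,y′)}.
[cite: Balaban1985BackgroundPropagators, (3.95) p.411 + p.422; Balaban1984PropagatorsII, (2.85) p.238] -/
theorem localizedExp_transport {g₁ g₂ : B9.Geometry} [Fintype g₁.Site] [DecidableEq g₁.Site] [Fintype g₂.Site]
    [DecidableEq g₂.Site] {R₁ R₂ : ℝ} {H₁ H₂ : Prop} {e₁ : g₁.Site → S} {e₂ : g₂.Site → S}
    (he₁ : Function.Injective e₁) (he₂ : Function.Injective e₂) (Θ ρ δ₀ c : ℝ) (hΘ : 0 ≤ Θ) (hρ : 0 ≤ ρ)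
    (hδ₀ : 0 ≤ δ₀) (S₁ : Finset g₁.Site) (S₂ : Finset g₂.Site)
    (hS : ∀ b y', e₁ b = e₂ y' → b ∈ S₁ → y' ∈ S₂)
    (hdist : ∀ a b y y', e₁ a = e₂ y → e₁ b = e₂ y' → c * g₂.dist y y' ≤ g₁.dist a b)
    {A : Module.End ℝ (g₁.Site → ℝ)}
    (hA : B6RandomWalk.HasMajorant (g := B9Thm34Ext.toB6 g₁ R₁ H₁) (fun x : g₁.Site => x) A
      (fun (a b : g₁.Site) => (if b ∈ S₁ then (1 : ℝ) else 0) * Θ * Real.exp (-(ρ * δ₀ * g₁.dist a b)))) :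
    B6RandomWalk.HasMajorant (g := B9Thm34Ext.toB6 g₂ R₂ H₂) (fun x : g₂.Site => x) (compress e₂ (dilate e₁ A))
      (fun (y y' : g₂.Site) => (if y' ∈ S₂ then (1 : ℝ) else 0) * Θ * Real.exp (-(c * (ρ * δ₀) * g₂.dist y y'))) := by
  refine hasMajorant_compress_dilate he₁ he₂ _ hA (fun y y' => ?_) (fun a b y y' ha hb => ?_)
  · exact mul_nonneg (mul_nonneg (by split_ifs <;> norm_num) hΘ) (Real.exp_nonneg _)
  · by_cases hbS : b ∈ S₁
    · rw [if_pos hbS, if_pos (hS b y' hb hbS), one_mul]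
      exact exp_rate_le_of_dist_ge Θ (ρ * δ₀) c _ _ hΘ (mul_nonneg hρ hδ₀) (hdist a b y y' ha hb)
    · rw [if_neg hbS, zero_mul, zero_mul]
      exact mul_nonneg (mul_nonneg (by split_ifs <;> norm_num) hΘ) (Real.exp_nonneg _)

end Transport

end Literature.MathematicalPhysics.QuantumFieldTheory.Balaban1983to89.B9Eq395Transport
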